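import Summits.KontsevichZagierPeriods.KontsevichZagierPeriods.Theorems.TerasomaMultiplicationBetaCancellationStubFibreSubstitutionAE
import Summits.KontsevichZagierPeriods.KontsevichZagierPeriods.Theorems.TerasomaMultiplicationBetaCancellationStubEquivalentOfAEJacobian
import Summits.KontsevichZagierPeriods.KontsevichZagierPeriods.Theorems.TerasomaMultiplicationBetaCancellationStubAbsDetFDerivSemialgebraic
import Summits.KontsevichZagierPeriods.KontsevichZagierPeriods.Theorems.TerasomaMultiplicationGammaHodgeSectorDefs
import Literature.NumberTheory.Transcendental.KZLogCalculusProofs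
import Literature.ModelTheory.ExponentialFields.SemialgebraicInterior

/-!
# `BetaCancellation` (stmt-KontsevichZagierPeriods-13633), line `dirichlet-companion-to-pi` — stub `stub_fibreSubstitution` (assembly, seat c14): FIBRE-FORM CATALYTIC SUBSTITUTIONS DESCEND

**The sector.** Seats c7–c9 of this crux descended certificates of `[p] ⋆ c ∈ KZ.relations` by one
fixed linear integrand operator checked generator by generator (restriction, wall, side, region,
weight, weight2), and showed that method closed (crux notes c8 W3, c9 G3, c12 I5). Seat c12 (I1)
isolated the smallest open object — ONE rule-(2) substitution `Φ : p ⊗ r → p ⊗ r'` between two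
pinned products ("catalytic one-map equidecomposition ⇒ equidecomposition") — and named on paper its
one descending sub-case: `Φ` of FIBRE FORM `Φ (x, w) = (φ (x, w), ψ w)`. This file proves that
sub-case for an ARBITRARY catalyst `p : IntegralRep d` of non-zero value:

* `stub_fibreSubstitution` — if `q = p ⊗ r` and `q' = p ⊗ r'` (crux coordinates: catalyst
  `Fin.castAdd n i`, factor `Fin.natAdd d j`) are related by ONE change of variables of fibre form
  over a `ℚ`-semialgebraic substitution `ψ` of the bases, injective on `r.domain` with a derivative
  within it, then `r ∼ r'`;
* `isPinned_fibreSubstitution` — the same for every kernel representation on `(0,1)` of non-zero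
  value in the crux's kernel vocabulary (`BetaCancellationNegative.IsPinned`);
* `betaCancellation_of_fibreSubstitution` — **the crux's literal hypotheses at ALL positive rational
  exponents `(a, b)`**, with `q ∼ q'` replaced by one explicit fibre-form substitution: `r ∼ r'`;
* `disc_fibreSubstitution` — the disc `[π]` (item 0540's catalyst), closed-term convention
  `piRep.prod`.

**The mechanism** is not an operator on certificates: the change-of-variables formula for `Φ`
tested against the cylinders `K × A`, Fubini on both products and the NUMERIC cancellation of
`p.value ≠ 0` give the rule-(2) identity `f = (f' ∘ ψ) · |det ψ'|` almost everywhere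
(`stub_fibreSubstitutionAE`, p130447); on the interior `U` of `r.domain` (co-null,
`ℚ`-semialgebraic, open) the derivative `ψ'` is `fderiv ℝ ψ`, whose absolute Jacobian is
`ℚ`-semialgebraic (`stub_absDetFDeriv_semialgebraic`, p130598); so the defect set is null AND
`ℚ`-semialgebraic and the a.e. identity is ONE rule-(2) move plus co-null restrictions
(`stub_equivalent_of_aeJacobian`, p130659); the image side is co-null because `ψ` maps null sets
to null sets (area inequality). Such substitutions move the catalyst coordinate across every chord
and preserve no weight, so this certificate class is incomparable with every class descended in the
tree; what remains open of the one-substitution form is a `Φ` that does NOT map catalyst fibres into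
catalyst fibres (crux notes c11 H5). No definitions; sorry-free; axioms ⊆ {propext, Classical.choice,
Quot.sound}.

References: M. Kontsevich, D. Zagier, *Periods* (2001), §1.2 rule (2); J. Ayoub, *Une version
relative de la conjecture des périodes de Kontsevich–Zagier*, Ann. of Math. 181 (2015), Rem. 1.3.
-/

noncomputable section

-- `Summit.KontsevichZagierPeriods.KontsevichZagierPeriods.…` is the tree's mandated layout (single-conjunct summit).
set_option linter.dupNamespace false

namespace Summit.KontsevichZagierPeriods.KontsevichZagierPeriods.BetaCancellationLine

open MeasureTheory Set
open Literature.ModelTheory.ExponentialFields (IsSemialgebraic isSemialgebraic_interior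
  isSemialgebraic_diff_interior)
open Literature.NumberTheory.Transcendental
open Literature.NumberTheory.Transcendental.KZ

/-! ### The assembly -/

/-- STUB (assembly, held by the lead, seat c14). **Fibre-form catalytic substitutions descend.** For a
catalyst `p : IntegralRep d` of NON-ZERO value, if the pinned products `q = p ⊗ r` and `q' = p ⊗ r'`
(crux coordinates: catalyst `Fin.castAdd n i`, factor `Fin.natAdd d j`) are related by ONE
change-of-variables move `Φ` of fibre form over a `ℚ`-semialgebraic substitution `ψ` which is injective
on `r.domain` with a derivative within it, then `r ∼ r'` — by the three stubs above through the
interior of `r.domain` (co-null, `ℚ`-semialgebraic, open; there `ψ' = fderiv ℝ ψ`). The first descent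
in the tree that is not a restriction/multiplier operator: it cancels `p.value` numerically, fibre by
fibre. With `p` the Beta kernel this is a sector of the crux at ALL exponents; with `p = piRep` a
sector of item 0540. [folklore] -/
theorem stub_fibreSubstitution {d n : ℕ} (p : IntegralRep d) (hp : p.value ≠ 0)
    (r r' : IntegralRep n) (q q' : IntegralRep (d + n))
    (hq : q.domain = {z | (fun i => z (Fin.castAdd n i)) ∈ p.domain ∧
      (fun j => z (Fin.natAdd d j)) ∈ r.domain})
    (hqi : Set.EqOn q.integrand (fun z => p.integrand (fun i => z (Fin.castAdd n i)) *
      r.integrand (fun j => z (Fin.natAdd d j))) q.domain)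
    (hq' : q'.domain = {z | (fun i => z (Fin.castAdd n i)) ∈ p.domain ∧
      (fun j => z (Fin.natAdd d j)) ∈ r'.domain})
    (hq'i : Set.EqOn q'.integrand (fun z => p.integrand (fun i => z (Fin.castAdd n i)) *
      r'.integrand (fun j => z (Fin.natAdd d j))) q'.domain)
    (Φ : (Fin (d + n) → ℝ) → (Fin (d + n) → ℝ))
    (Φ' : (Fin (d + n) → ℝ) → (Fin (d + n) → ℝ) →L[ℝ] (Fin (d + n) → ℝ))
    (hΦ' : ∀ z ∈ q.domain, HasFDerivWithinAt Φ (Φ' z) q.domain z) (hΦinj : Set.InjOn Φ q.domain)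
    (himg : q'.domain = Φ '' q.domain)
    (hjac : ∀ z ∈ q.domain, q.integrand z = q'.integrand (Φ z) * |(Φ' z).det|)
    (ψ : (Fin n → ℝ) → (Fin n → ℝ)) (ψ' : (Fin n → ℝ) → (Fin n → ℝ) →L[ℝ] (Fin n → ℝ))
    (hψsa : IsSemialgebraicMapOn ℚ r.domain ψ)
    (hfib : ∀ z ∈ q.domain, (fun j => Φ z (Fin.natAdd d j)) = ψ (fun j => z (Fin.natAdd d j)))
    (hψ' : ∀ w ∈ r.domain, HasFDerivWithinAt ψ (ψ' w) r.domain w) (hψinj : Set.InjOn ψ r.domain) :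
    Equivalent r r' := by
  -- (0) the a.e. rule-(2) identity on `σ := r.domain` (measure core)
  have hae := stub_fibreSubstitutionAE p hp r r' q q' hq hqi hq' hq'i Φ Φ' hΦ' hΦinj himg hjac
    ψ ψ' hfib hψ' hψinj
  have hσm : MeasurableSet r.domain := IntegralRep.measurableSet_domain_holds r
  -- (1) `σ' = ψ '' σ`
  have hKne : p.domain.Nonempty := by
    by_contra h
    apply hp
    rw [not_nonempty_iff_eq_empty] at h
    simp [IntegralRep.value, h]
  obtain ⟨x₀, hx₀⟩ := hKne
  have hmemq : ∀ z, z ∈ q.domain ↔ (fun i => z (Fin.castAdd n i)) ∈ p.domain ∧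
      (fun j => z (Fin.natAdd d j)) ∈ r.domain := fun z => by rw [hq]; rfl
  have hmemq' : ∀ z, z ∈ q'.domain ↔ (fun i => z (Fin.castAdd n i)) ∈ p.domain ∧
      (fun j => z (Fin.natAdd d j)) ∈ r'.domain := fun z => by rw [hq']; rfl
  have hσ' : r'.domain = ψ '' r.domain := by
    apply Subset.antisymm
    · intro w' hw'
      have hz' : Fin.append x₀ w' ∈ q'.domain := by
        rw [hmemq']
        simpa using And.intro hx₀ hw'
      rw [himg] at hz'
      obtain ⟨z, hz, hzw⟩ := hz'
      refine ⟨fun j => z (Fin.natAdd d j), ((hmemq z).1 hz).2, ?_⟩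
      rw [← hfib z hz, hzw]
      funext j
      simp
    · rintro _ ⟨w, hw, rfl⟩
      have hz : Fin.append x₀ w ∈ q.domain := by
        rw [hmemq]
        simpa using And.intro hx₀ hw
      have hz' : Φ (Fin.append x₀ w) ∈ q'.domain := himg ▸ mem_image_of_mem Φ hz
      rw [hmemq', hfib _ hz] at hz'
      simpa using hz'.2
  -- (2) pass to the interior `U` of `σ`
  set U : Set (Fin n → ℝ) := interior r.domain with hU
  have hUσ : U ⊆ r.domain := interior_subset
  have hUs : IsSemialgebraic ℚ U := isSemialgebraic_interior r.isSemialgebraic_domain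
  have hUo : IsOpen U := isOpen_interior
  have hU0 : volume (r.domain \ U) = 0 :=
    volume_eq_zero_of_interior_eq_empty (isSemialgebraic_diff_interior r.isSemialgebraic_domain).1
      (isSemialgebraic_diff_interior r.isSemialgebraic_domain).2
  set r₀ : IntegralRep n := r.restrict U hUs hUσ with hr₀
  have h1 : of r - of r₀ ∈ relations := IntegralRep.of_sub_of_restrict_mem_relations r hUs hUσ hU0
  -- (3) the image side
  have hψU : IsSemialgebraic ℚ (ψ '' U) :=
    IsSemialgebraicMapOn.isSemialgebraic_image_holds hψsa hUσ hUs
  have hψUσ' : ψ '' U ⊆ r'.domain := hσ' ▸ image_mono hUσ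
  set r'₀ : IntegralRep n := r'.restrict (ψ '' U) hψU hψUσ' with hr'₀
  have h2 : of r' - of r'₀ ∈ relations := by
    refine IntegralRep.of_sub_of_restrict_mem_relations r' hψU hψUσ' ?_
    have hsub : r'.domain \ ψ '' U ⊆ ψ '' (r.domain \ U) := by
      intro w' hw'
      rw [hσ'] at hw'
      obtain ⟨⟨w, hw, rfl⟩, hnot⟩ := hw'
      exact ⟨w, ⟨hw, fun hwU => hnot (mem_image_of_mem ψ hwU)⟩, rfl⟩
    exact measure_mono_null hsub (aeJacobian_volume_image_null ψ ψ' hψ' (fun _ h => h.1)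
      (hσm.diff hUo.measurableSet) hU0)
  -- (4) on `U`, `ψ' = fderiv ℝ ψ`, so `|det ψ'|` is semialgebraic there
  have hfd : ∀ w ∈ U, HasFDerivAt ψ (ψ' w) w := fun w hw =>
    (hψ' w (hUσ hw)).hasFDerivAt (mem_interior_iff_mem_nhds.1 hw)
  have hdet : IsSemialgebraicFunOn ℚ U fun w => |(ψ' w).det| :=
    (stub_absDetFDeriv_semialgebraic hUo hUs ψ (hψsa.mono hUσ hUs)
      fun w hw => (hfd w hw).differentiableAt).congr fun w hw => by
        show |(fderiv ℝ ψ w).det| = _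
        rw [(hfd w hw).fderiv]
  -- (5) the bookkeeping stub on the restricted representations
  have h3 : Equivalent r₀ r'₀ := by
    refine stub_equivalent_of_aeJacobian r₀ r'₀ ψ ψ' (hψsa.mono hUσ hUs)
      (fun w hw => (hψ' w (hUσ hw)).mono hUσ) (hψinj.mono hUσ) rfl hdet ?_
    have := (ae_restrict_of_ae_restrict_of_subset hUσ hae)
    simpa [hr₀, hr'₀] using this
  -- (6) assemble
  have h123 : of r - of r' = (of r - of r₀) + (of r₀ - of r'₀) - (of r' - of r'₀) := by abel
  change of r - of r' ∈ relations
  rw [h123]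
  exact relations.sub_mem (relations.add_mem h1 h3) h2


/-! ### Corollaries in the crux's vocabularies: kernels on `(0,1)`, the Beta kernel, the disc -/

section Corollaries

open Summit.KontsevichZagierPeriods.KontsevichZagierPeriods.BetaCancellationNegative
  (IsPinned pinDomain pinFun betaKernel)
open Summit.KontsevichZagierPeriods.GammaHodgeSectorKO (betaRep betaRep_value_pos)
open Literature.NumberTheory.Transcendental.KZreg (unitIoo)

/-- **Kernel form.** For ANY kernel representation `κ` on `(0,1)` of non-zero value (`κ.integrand
x = k (x 0)` on `(0,1)`): if `q`, `q'` are pinned over `r`, `r'` with kernel `k`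
(`BetaCancellationNegative.IsPinned`) and related by ONE change of variables of fibre form over an
injective `ℚ`-semialgebraic substitution `ψ` of the bases, then `r ∼ r'`. [folklore] -/
theorem isPinned_fibreSubstitution {n : ℕ} {k : ℝ → ℝ} (κ : IntegralRep 1)
    (hκd : κ.domain = unitIoo) (hκi : EqOn κ.integrand (fun x => k (x 0)) κ.domain)
    (hκ0 : κ.value ≠ 0) (r r' : IntegralRep n) (q q' : IntegralRep (1 + n))
    (hq : IsPinned k r q) (hq' : IsPinned k r' q')
    (Φ : (Fin (1 + n) → ℝ) → (Fin (1 + n) → ℝ))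
    (Φ' : (Fin (1 + n) → ℝ) → (Fin (1 + n) → ℝ) →L[ℝ] (Fin (1 + n) → ℝ))
    (hΦ' : ∀ z ∈ q.domain, HasFDerivWithinAt Φ (Φ' z) q.domain z) (hΦinj : Set.InjOn Φ q.domain)
    (himg : q'.domain = Φ '' q.domain)
    (hjac : ∀ z ∈ q.domain, q.integrand z = q'.integrand (Φ z) * |(Φ' z).det|)
    (ψ : (Fin n → ℝ) → (Fin n → ℝ)) (ψ' : (Fin n → ℝ) → (Fin n → ℝ) →L[ℝ] (Fin n → ℝ))
    (hψsa : IsSemialgebraicMapOn ℚ r.domain ψ)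
    (hfib : ∀ z ∈ q.domain, (fun j => Φ z (Fin.natAdd 1 j)) = ψ (fun j => z (Fin.natAdd 1 j)))
    (hψ' : ∀ w ∈ r.domain, HasFDerivWithinAt ψ (ψ' w) r.domain w) (hψinj : Set.InjOn ψ r.domain) :
    Equivalent r r' := by
  have hdom : ∀ σ : Set (Fin n → ℝ), pinDomain σ =
      {z : Fin (1 + n) → ℝ | (fun i => z (Fin.castAdd n i)) ∈ κ.domain ∧
        (fun j => z (Fin.natAdd 1 j)) ∈ σ} := by
    intro σ
    ext z
    simp only [pinDomain, mem_setOf_eq, mem_Ioo, hκd, KZreg.unitIoo]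
  have hint : ∀ (s : IntegralRep n) (t : IntegralRep (1 + n)), IsPinned k s t →
      EqOn t.integrand (fun z => κ.integrand (fun i => z (Fin.castAdd n i)) *
        s.integrand (fun j => z (Fin.natAdd 1 j))) t.domain := by
    intro s t ht z hz
    rw [ht.2 hz]
    have hz0 : (fun i => z (Fin.castAdd n i)) ∈ κ.domain := by
      have := hz
      rw [ht.1, hdom] at this
      exact this.1
    simp only [pinFun, hκi hz0]
  exact stub_fibreSubstitution κ hκ0 r r' q q' (hq.1.trans (hdom _)) (hint r q hq)
    (hq'.1.trans (hdom _)) (hint r' q' hq') Φ Φ' hΦ' hΦinj himg hjac ψ ψ' hψsa hfib hψ' hψinj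

/-- **The crux's sector at ALL exponents (seat c14).** `BetaCancellation` with its hypothesis
`q ∼ q'` replaced by ONE explicit change of variables `Φ : q → q'` of FIBRE FORM over an injective
`ℚ`-semialgebraic substitution `ψ` of the bases (everything else verbatim: positive rational
exponents, both pins): then `r ∼ r'`. No integrality of `a`, `b`, no passage through `[π]`: the Beta
value `B(a,b) ≠ 0` is cancelled numerically, fibre by fibre. [folklore] -/
theorem betaCancellation_of_fibreSubstitution (a b : ℚ) (ha : 0 < a) (hb : 0 < b) {n : ℕ}
    (r r' : IntegralRep n) (q q' : IntegralRep (1 + n))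
    (hq : q.domain = {z | z (Fin.castAdd n 0) ∈ Set.Ioo (0:ℝ) 1 ∧
      (fun j => z (Fin.natAdd 1 j)) ∈ r.domain})
    (hqi : Set.EqOn q.integrand (fun z => (z (Fin.castAdd n 0)) ^ ((a:ℝ) - 1) *
      (1 - z (Fin.castAdd n 0)) ^ ((b:ℝ) - 1) * r.integrand (fun j => z (Fin.natAdd 1 j))) q.domain)
    (hq' : q'.domain = {z | z (Fin.castAdd n 0) ∈ Set.Ioo (0:ℝ) 1 ∧
      (fun j => z (Fin.natAdd 1 j)) ∈ r'.domain})
    (hq'i : Set.EqOn q'.integrand (fun z => (z (Fin.castAdd n 0)) ^ ((a:ℝ) - 1) *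
      (1 - z (Fin.castAdd n 0)) ^ ((b:ℝ) - 1) * r'.integrand (fun j => z (Fin.natAdd 1 j)))
      q'.domain)
    (Φ : (Fin (1 + n) → ℝ) → (Fin (1 + n) → ℝ))
    (Φ' : (Fin (1 + n) → ℝ) → (Fin (1 + n) → ℝ) →L[ℝ] (Fin (1 + n) → ℝ))
    (hΦ' : ∀ z ∈ q.domain, HasFDerivWithinAt Φ (Φ' z) q.domain z) (hΦinj : Set.InjOn Φ q.domain)
    (himg : q'.domain = Φ '' q.domain)
    (hjac : ∀ z ∈ q.domain, q.integrand z = q'.integrand (Φ z) * |(Φ' z).det|)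
    (ψ : (Fin n → ℝ) → (Fin n → ℝ)) (ψ' : (Fin n → ℝ) → (Fin n → ℝ) →L[ℝ] (Fin n → ℝ))
    (hψsa : IsSemialgebraicMapOn ℚ r.domain ψ)
    (hfib : ∀ z ∈ q.domain, (fun j => Φ z (Fin.natAdd 1 j)) = ψ (fun j => z (Fin.natAdd 1 j)))
    (hψ' : ∀ w ∈ r.domain, HasFDerivWithinAt ψ (ψ' w) r.domain w) (hψinj : Set.InjOn ψ r.domain) :
    Equivalent r r' :=
  isPinned_fibreSubstitution (k := betaKernel a b) (betaRep a b ha hb) rfl (fun _ _ => rfl)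
    (betaRep_value_pos a b ha hb).ne' r r' q q' ⟨hq, hqi⟩ ⟨hq', hq'i⟩ Φ Φ' hΦ' hΦinj himg hjac
    ψ ψ' hψsa hfib hψ' hψinj

/-- **The disc (item 0540's catalyst), closed-term convention `piRep.prod`.** If `q = [π] ⊗ r` and
`q' = [π] ⊗ r'` (domain `{x² + y² ≤ 1} × σ`, integrand `f ∘ tail`) are related by ONE change of
variables of fibre form over an injective `ℚ`-semialgebraic substitution `ψ` of the bases, then
`r ∼ r'`: `π ≠ 0` is cancelled numerically, fibre by fibre. [folklore] -/
theorem disc_fibreSubstitution {n : ℕ} (r r' : IntegralRep n) (q q' : IntegralRep (2 + n))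
    (hq : q.domain = {z | (fun i => z (Fin.castAdd n i)) ∈ piDisc ∧
      (fun j => z (Fin.natAdd 2 j)) ∈ r.domain})
    (hqi : Set.EqOn q.integrand (fun z => r.integrand (fun j => z (Fin.natAdd 2 j))) q.domain)
    (hq' : q'.domain = {z | (fun i => z (Fin.castAdd n i)) ∈ piDisc ∧
      (fun j => z (Fin.natAdd 2 j)) ∈ r'.domain})
    (hq'i : Set.EqOn q'.integrand (fun z => r'.integrand (fun j => z (Fin.natAdd 2 j))) q'.domain)
    (Φ : (Fin (2 + n) → ℝ) → (Fin (2 + n) → ℝ))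
    (Φ' : (Fin (2 + n) → ℝ) → (Fin (2 + n) → ℝ) →L[ℝ] (Fin (2 + n) → ℝ))
    (hΦ' : ∀ z ∈ q.domain, HasFDerivWithinAt Φ (Φ' z) q.domain z) (hΦinj : Set.InjOn Φ q.domain)
    (himg : q'.domain = Φ '' q.domain)
    (hjac : ∀ z ∈ q.domain, q.integrand z = q'.integrand (Φ z) * |(Φ' z).det|)
    (ψ : (Fin n → ℝ) → (Fin n → ℝ)) (ψ' : (Fin n → ℝ) → (Fin n → ℝ) →L[ℝ] (Fin n → ℝ))
    (hψsa : IsSemialgebraicMapOn ℚ r.domain ψ)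
    (hfib : ∀ z ∈ q.domain, (fun j => Φ z (Fin.natAdd 2 j)) = ψ (fun j => z (Fin.natAdd 2 j)))
    (hψ' : ∀ w ∈ r.domain, HasFDerivWithinAt ψ (ψ' w) r.domain w) (hψinj : Set.InjOn ψ r.domain) :
    Equivalent r r' :=
  stub_fibreSubstitution piRep (by rw [piRep_value]; exact Real.pi_ne_zero) r r' q q' hq
    (fun z hz => by rw [hqi hz]; simp) hq'
    (fun z hz => by rw [hq'i hz]; simp) Φ Φ' hΦ' hΦinj himg hjac ψ ψ' hψsa
    hfib hψ' hψinj

end Corollaries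

end Summit.KontsevichZagierPeriods.KontsevichZagierPeriods.BetaCancellationLine

end
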